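import Literature.Geometry.Kaehler.ToroidalGroupIrrationalityCriterion
import Literature.Algebra.Module.DiscreteSubgroupLattice
import Mathlib.NumberTheory.NumberField.InfinitePlace.Basic
import Mathlib.NumberTheory.NumberField.Norm
import Mathlib.RingTheory.Discriminant
import Mathlib.FieldTheory.PrimitiveElement
import Mathlib.Analysis.Normed.Operator.Mul
import HarnessLib

/-!
# Toroidal groups from number fields: the lattice `μ_Φ(𝓞_K) ⊂ ℂ^{r₁+r₂}` (Vallières; Andreotti–Gherardelli, Abe)

Sources.  D. Vallières, *Connected abelian complex Lie groups and number fields*, J. Théor. Nombres Bordeaux 24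
(2012) 201–229, §3 (open access, read on pp. 212–214):

«**Definition 6.** Let `K` be a number field, and let `r = r₁ + r₂`, where as usual `r₁` (resp. `2r₂`) is the
number of real (resp. complex) embeddings of `K`.  A complete set `Φ = {σ₁, …, σ_r}` of representatives modulo
complex conjugation for the embeddings of `K` into `ℂ` where the first `r₁` embeddings are real will be called a
type. … To any type `Φ` for `K`, one can associate the Minkowski map `μ_Φ : K → ℂ^r`, defined by
`λ ↦ (σ₁(λ), …, σ_r(λ))`.
**Theorem 4.** Let `K` be a number field of degree `n` over `ℚ` and let `Φ` be a type of `K`.  Given any free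
`ℤ`-module `𝔪` of rank `n` in `K`, the free `ℤ`-module `μ_Φ(𝔪)` is in fact a lattice in `ℂ^r`.  Moreover
• `rank(μ_Φ(𝔪)) = r₁ + 2r₂ = [K : ℚ]`, • `rank_ℂ(μ_Φ(𝔪)) = r₁ + r₂ = r`.
*Proof.* … we just have to show that the vectors `μ_Φ(β₁), …, μ_Φ(β_n)` are `ℝ`-linearly independent. Suppose
they are not … [conjugating the relation gives it for all `r₁ + 2r₂` embeddings] This would contradict the fact
that `disc(β₁, …, β_n) ≠ 0`. … since the matrix `(σ_i(β_j))` has full rank we conclude as well that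
`rank_ℂ(μ_Φ(𝔪)) = r = r₁ + r₂`.»  «If `K` is totally real, then Corollary 1 and Theorem 4 show that
`ℂ^r/μ_Φ(𝔞) ≃ (ℂ^×)^{r₁}`.»
«**Theorem 5.** Let `K` be a non-totally real cubic number field and `𝔞` a fractional ideal of `K`.  The
connected abelian complex Lie group `ℂ²/μ_Φ(𝔞)` is a Cousin group.  *Proof.* We use Theorem 2 [the
irrationality criterion]. Let `L ∈ Hom_ℂ(ℂ², ℂ)` be such that `L(μ_Φ(𝔞)) ⊆ ℤ` … Taking complex conjugation …
we conclude that `z₁ ∈ ℝ` and `z₂ = 0` … Since the `αᵢ` are **Q**-linearly independent … `L` is the trivial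
map.  **Remark.** As noted by the referee, the same proof works for any number field satisfying `r₁ = 1` and
`r₂ ≥ 1`.»  («a Cousin group is sometimes called a (H,C)-group or a toroidal group», Def. 4.)

The general case — for EVERY non-totally real `K` the group `ℂ^{r₁+r₂}/μ_Φ(𝓞_K)` is toroidal — is due to
Andreotti–Gherardelli (1974) and Y. Abe [Abe2013QuasiAbelianCM] (paywalled, acquisition request acq-14858), as
reported in [DioguardiBurgioFalconeGalici2024, Introduction, p. 341]: «Y. Abe in [1] showed that, given a
non-totally real number field `K` of degree `δ = r₁ + 2r₂` and a Minkowski map `μ : K → ℂ^{r₁+r₂}`, the image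
`μ(O_K)` is a lattice `Λ` of complex rank `r₁ + r₂` and real rank `δ`, such that the quotient group
`ℂ^{r₁+r₂}/Λ` is a toroidal group».

## Dictionary

`K` a number field (Mathlib `NumberField K`); the infinite places `w : InfinitePlace K` come with Mathlib's
chosen representative `w.embedding : K →+* ℂ` of the conjugacy class `{φ, φ̄}` — so `w ↦ w.embedding` IS a type
`Φ` in VALLIÈRES' sense (real places have real embeddings, `InfinitePlace.isReal_iff`), `ℂ^r` is the complex
vector space `InfinitePlace K → ℂ` (`r = r₁ + r₂` coordinates) and the Minkowski map is
`μ x = fun w ↦ w.embedding x`.  The lattice `Λ = μ(𝓞_K)` is any additive subgroup with the membership clause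
`hΛ : ∀ v, v ∈ Λ ↔ ∃ x : 𝓞 K, (fun w ↦ w.embedding x) = v` (no definition is introduced; `exists_addSubgroup_iff`
provides it).  «Toroidal» and the irrationality condition are those of the tree's
`ToroidalGroupIrrationalityCriterion` (`ToroidalGroup.forall_periodic_const_iff_forall_eq_zero`).

## What is proved (THEOREMS ONLY; no definition, no named fact, no instance)

* §1 DEDEKIND's independence of embeddings in the two forms used: a `ℂ`-linear combination of distinct
  embeddings `K →+* ℂ` vanishing on a `ℚ`-basis is trivial (`eq_zero_of_sum_mul_embedding_eq_zero`), and — the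
  heart of the toroidality — one taking INTEGER values on a `ℚ`-basis is trivial as soon as some embedding of `K`
  is missing from the family (`eq_zero_of_sum_mul_embedding_mem_int`: the `ℚ`-valued functional is `Tr(c₀ ·)`
  by the nondegeneracy of the trace form, `Tr = Σ_τ τ` over all embeddings, and Dedekind's lemma forces
  `τ₀(c₀) = 0` at the missing embedding `τ₀`).  This replaces VALLIÈRES' conjugation-and-determinant step (which
  needs `r₁ = 1`) and yields the general case.
* §2 THEOREM 4: for every `ℚ`-basis `b` of `K` the vectors `μ(b_k)` are `ℝ`-linearly independent
  (`linearIndependent_real_minkowski`, the printed proof: conjugation + `disc ≠ 0` via Mathlib's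
  `Algebra.discr_not_zero_of_basis` / `discr_eq_det_embeddingsMatrixReindex_pow_two`), `μ(𝓞_K)` is DISCRETE
  (`discreteTopology_of_forall_mem_iff`) and spans `ℂ^r` over `ℂ` (`span_eq_top_of_forall_mem_iff`, «rank_ℂ = r»).
* §3 THEOREM 5 / ANDREOTTI–GHERARDELLI / ABE: if `K` has a complex place then no non-zero `ℂ`-linear functional
  on `ℂ^r` is integral on `μ(𝓞_K)` (`eq_zero_of_forall_mem_exists_int`), hence `ℂ^r/μ(𝓞_K)` is toroidal; if `K`
  is totally real the trace `Σ_w z_w` is a non-zero integral functional (`exists_ne_zero_forall_mem_exists_int`,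
  «`ℂ^r/μ_Φ(𝔞) ≃ (ℂ^×)^{r₁}`» is not toroidal); together: `ℂ^{r₁+r₂}/μ(𝓞_K)` **is toroidal iff `K` is not
  totally real** (`forall_periodic_const_iff_exists_isComplex`).
* §4 The same for an arbitrary full module `𝔪 = ℤb₁ ⊕ ⋯ ⊕ ℤb_n ⊂ K` (`b` a `ℚ`-basis: fractional ideals, orders),
  as VALLIÈRES states Thm. 4 («any free `ℤ`-module `𝔪` of rank `n` in `K`») and Thm. 5 (fractional ideals `𝔞`):
  `discreteTopology_of_forall_mem_iff_span`, `span_eq_top_of_forall_mem_iff_span`,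
  `eq_zero_of_forall_mem_exists_int_span`, `forall_periodic_const_of_exists_isComplex_span`.
* §5 EXTRA MULTIPLICATIONS (VALLIÈRES Def. 7, Thm. 9 first part): for `λ ∈ 𝓞_K` the diagonal map
  `ι(λ) = ContinuousLinearMap.mul ℂ _ (μ λ)` preserves `μ_Φ(𝔪)` for every `𝓞_K`-stable `𝔪`
  (`mul_minkowski_mem`, `mul_minkowski_mem_ringOfIntegers`), `λ ↦ ι(λ)` is multiplicative and injective
  (`mul_minkowski_mul`, `mul_minkowski_injective`), and for `K ≠ ℚ` some `ι(λ)` is not multiplication by a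
  rational integer (`exists_endomorphism_ne_intCast`: «a Cousin group having extra multiplication»).

## References
* [Vallieres2012ConnectedAbelianLieGroups] D. Vallières, *Connected abelian complex Lie groups and number
  fields*, J. Théor. Nombres Bordeaux 24 (2012) 201–229, doi:10.5802/jtnb.793 — Def. 3–7, Thm. 2, Cor. 1,
  Thm. 4, Thm. 5 and Remark, Thm. 9 (pp. 206–222).
* [DioguardiBurgioFalconeGalici2024] A. Dioguardi Burgio, G. Falcone, M. Galici, *Non-totally real number fields
  and toroidal groups*, J. Théor. Nombres Bordeaux 36 (2024) 339–359, doi:10.5802/jtnb.1281 — Introduction.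
* [Abe2013QuasiAbelianCM] Y. Abe, *𝔬_{K₀}-quasi-abelian varieties with complex multiplication*, Forum Math. 25
  (2013) 677–702, doi:10.1515/form.2011.132 (general toroidality statement; not read — acq-14858).
* [AbeKopfermann2001] Y. Abe, K. Kopfermann, *Toroidal Groups*, LNM 1759 (2001), §1.1 Thm. 1.1.4 (irrationality
  criterion, the tree's `ToroidalGroupIrrationalityCriterion`).
-/

noncomputable section

open Finset NumberField NumberField.InfinitePlace

namespace Literature.Geometry.Kaehler

namespace ToroidalGroup

variable {K : Type*} [Field K] [NumberField K]

/-! ## §1 Dedekind's independence of the embeddings -/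

/-- Bookkeeping for Dedekind's lemma: if `Σ_i c_i (e i) = Σ_τ d_τ τ` as `ℚ`-linear maps `K → ℂ`, for an injective
family `e` of `ℚ`-algebra embeddings, then `d` vanishes off the range of `e` and `d (e i) = c i`. [folklore] -/
private theorem dedekind_coeff {ι : Type*} [Fintype ι] (e : ι → (K →ₐ[ℚ] ℂ)) (he : Function.Injective e)
    (c : ι → ℂ) (d : (K →ₐ[ℚ] ℂ) → ℂ)
    (h : ∑ i, c i • (e i).toLinearMap = ∑ τ : K →ₐ[ℚ] ℂ, d τ • τ.toLinearMap) :
    (∀ τ, (∀ i, e i ≠ τ) → d τ = 0) ∧ ∀ i, d (e i) = c i := by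
  classical
  have hind := linearIndependent_algHom_toLinearMap ℚ K ℂ
  -- rewrite the left-hand side fibrewise
  have hfib : ∑ i, c i • (e i).toLinearMap =
      ∑ τ : K →ₐ[ℚ] ℂ, (∑ i ∈ univ.filter (fun i ↦ e i = τ), c i) • τ.toLinearMap := by
    rw [← sum_fiberwise univ e (fun i ↦ c i • (e i).toLinearMap)]
    refine sum_congr rfl fun τ _ ↦ ?_
    rw [sum_smul]
    refine sum_congr rfl fun i hi ↦ ?_
    rw [(mem_filter.mp hi).2]
  have hrel : ∑ τ : K →ₐ[ℚ] ℂ, ((∑ i ∈ univ.filter (fun i ↦ e i = τ), c i) - d τ) • τ.toLinearMap = 0 := by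
    simp only [sub_smul, sum_sub_distrib, ← hfib, h, sub_self]
  have hτ : ∀ τ : K →ₐ[ℚ] ℂ, (∑ i ∈ univ.filter (fun i ↦ e i = τ), c i) - d τ = 0 :=
    fun τ ↦ Fintype.linearIndependent_iff.mp hind _ hrel τ
  refine ⟨fun τ hτ' ↦ ?_, fun i ↦ ?_⟩
  · have h0 := hτ τ
    rw [filter_eq_empty_iff.mpr (fun i _ ↦ hτ' i), sum_empty, zero_sub, neg_eq_zero] at h0
    exact h0
  · have h0 := hτ (e i)
    have hfilter : univ.filter (fun j ↦ e j = e i) = {i} := by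
      ext j
      simp [he.eq_iff]
    rw [hfilter, sum_singleton, sub_eq_zero] at h0
    exact h0.symm

/-- The `ℚ`-algebra embedding attached to a ring embedding, as an injective assignment. [folklore] -/
private theorem toRatAlgHom_injective_comp {ι : Type*} (Φ : ι → (K →+* ℂ)) (hΦ : Function.Injective Φ) :
    Function.Injective (fun i ↦ (Φ i).toRatAlgHom) := fun i j hij ↦
  hΦ (by simpa using congrArg (fun f : K →ₐ[ℚ] ℂ ↦ (f : K →+* ℂ)) hij)

/-- **DEDEKIND's lemma, first form**: a `ℂ`-linear combination of distinct embeddings `K →+* ℂ` which vanishes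
on a `ℚ`-basis of `K` is trivial. [cite: Vallieres2012ConnectedAbelianLieGroups, §3 proof of Thm. 4 («the matrix
`(σ_i(β_j))` has full rank»)] -/
theorem eq_zero_of_sum_mul_embedding_eq_zero {ι κ : Type*} [Fintype ι] (Φ : ι → (K →+* ℂ))
    (hΦ : Function.Injective Φ) (b : Module.Basis κ ℚ K) (c : ι → ℂ)
    (h : ∀ k, ∑ i, c i * Φ i (b k) = 0) : c = 0 := by
  classical
  have hlin : ∑ i, c i • ((Φ i).toRatAlgHom).toLinearMap = ∑ τ : K →ₐ[ℚ] ℂ, (0 : ℂ) • τ.toLinearMap := by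
    simp only [zero_smul, sum_const_zero]
    refine b.ext fun k ↦ ?_
    simpa using h k
  funext i
  exact ((dedekind_coeff _ (toRatAlgHom_injective_comp Φ hΦ) c _ hlin).2 i).symm

/-- **DEDEKIND's lemma with integral values — the heart of the toroidality of `ℂ^r/μ(𝓞_K)`**: let `Φ` be an
injective family of embeddings `K →+* ℂ` which MISSES some embedding `τ₀` of `K`; if a `ℂ`-linear combination
`Σ_i c_i Φ_i` takes integer values on a `ℚ`-basis `b` of `K`, then `c = 0`.  Proof: the `ℚ`-valued `ℚ`-linear
functional `f = Σ c_i Φ_i|_K` is `v ↦ Tr_{K/ℚ}(c₀ v)` for some `c₀ ∈ K` (the trace form is nondegenerate), and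
`Tr = Σ_τ τ` over all embeddings; by Dedekind's lemma the coefficient `τ₀(c₀)` of the missing embedding vanishes,
so `c₀ = 0` and `c = 0`.  (VALLIÈRES proves the case `r₁ = 1` by conjugation and `disc ≠ 0`; this argument gives
the general case stated by ANDREOTTI–GHERARDELLI and ABE.)
[cite: Vallieres2012ConnectedAbelianLieGroups, §3 Thm. 5 with proof and the Remark after it]
[cite: DioguardiBurgioFalconeGalici2024, Introduction p. 341 (report of Abe's theorem)] -/
theorem eq_zero_of_sum_mul_embedding_mem_int {ι κ : Type*} [Fintype ι] (Φ : ι → (K →+* ℂ))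
    (hΦ : Function.Injective Φ) {τ₀ : K →+* ℂ} (hτ₀ : ∀ i, Φ i ≠ τ₀) (b : Module.Basis κ ℚ K) (c : ι → ℂ)
    (h : ∀ k, ∃ m : ℤ, ∑ i, c i * Φ i (b k) = m) : c = 0 := by
  classical
  choose m hm using h
  -- the `ℚ`-valued functional and its trace representation
  let f : K →ₗ[ℚ] ℚ := b.constr ℚ fun k ↦ (m k : ℚ)
  have hf : ∀ k, f (b k) = m k := fun k ↦ by simp [f, Module.Basis.constr_basis]
  set c₀ : K := ((Algebra.traceForm ℚ K).toDual (traceForm_nondegenerate ℚ K)).symm f with hc₀_def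
  have hc₀ : ∀ v, Algebra.trace ℚ K (c₀ * v) = f v := fun v ↦ by
    rw [← Algebra.traceForm_apply, hc₀_def]
    exact LinearMap.BilinForm.apply_toDual_symm_apply f v
  -- `Σ_i c_i Φ_i = Σ_τ τ(c₀) τ` as `ℚ`-linear maps `K → ℂ`
  have hlin : ∑ i, c i • ((Φ i).toRatAlgHom).toLinearMap =
      ∑ τ : K →ₐ[ℚ] ℂ, (τ c₀) • τ.toLinearMap := by
    refine b.ext fun k ↦ ?_
    have h1 : (∑ i, c i • ((Φ i).toRatAlgHom).toLinearMap) (b k) = (m k : ℂ) := by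
      simpa using hm k
    have h2 : (∑ τ : K →ₐ[ℚ] ℂ, (τ c₀) • τ.toLinearMap) (b k) = (m k : ℂ) := by
      simp only [LinearMap.coe_sum, Finset.sum_apply, LinearMap.smul_apply, AlgHom.toLinearMap_apply,
        smul_eq_mul, ← map_mul]
      rw [← trace_eq_sum_embeddings ℂ, hc₀, hf, map_intCast]
    rw [h1, h2]
  obtain ⟨hmiss, hdiag⟩ := dedekind_coeff _ (toRatAlgHom_injective_comp Φ hΦ) c _ hlin
  -- the missing embedding kills `c₀`
  have hc₀0 : c₀ = 0 := by
    have h0 : τ₀.toRatAlgHom c₀ = 0 := hmiss τ₀.toRatAlgHom fun i hi ↦ hτ₀ i (by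
      simpa using congrArg (fun g : K →ₐ[ℚ] ℂ ↦ (g : K →+* ℂ)) hi)
    rw [RingHom.toRatAlgHom_apply, map_eq_zero] at h0
    exact h0
  funext i
  have := hdiag i
  rw [hc₀0, map_zero] at this
  exact this.symm

/-! ## §2 Theorem 4: `μ(𝔪)` is a lattice of real rank `[K:ℚ]` and complex rank `r₁ + r₂` -/

omit [NumberField K] in
/-- Every embedding `τ : K →+* ℂ` is the chosen representative of its place or its conjugate. [folklore] -/
private theorem embedding_mk_eq_or (τ : K →+* ℂ) :
    (mk τ).embedding = τ ∨ (mk τ).embedding = ComplexEmbedding.conjugate τ :=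
  embedding_mk_eq τ

/-- **THEOREM 4 (first bullet, the printed proof)**: for a `ℚ`-basis `b` of `K` (e.g. a `ℤ`-basis of a free
`ℤ`-module `𝔪 ⊂ K` of rank `[K:ℚ]`) the Minkowski vectors `μ(b_k) = (w.embedding (b_k))_w ∈ ℂ^{r₁+r₂}` are
linearly independent over `ℝ` («`rank(μ_Φ(𝔪)) = r₁ + 2r₂ = [K : ℚ]`»): a real relation, conjugated, holds for
all `[K:ℚ]` embeddings, contradicting `disc(β₁, …, β_n) ≠ 0`.
[cite: Vallieres2012ConnectedAbelianLieGroups, §3 Thm. 4 with proof (pp. 212–213)] -/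
theorem linearIndependent_real_minkowski {κ : Type*} [Fintype κ] (b : Module.Basis κ ℚ K) :
    LinearIndependent ℝ (fun k : κ ↦ fun w : InfinitePlace K ↦ (w.embedding (b k) : ℂ)) := by
  classical
  rw [Fintype.linearIndependent_iff]
  intro g hg
  -- the relation holds for every embedding
  have h1 : ∀ τ : K →+* ℂ, ∑ k, (g k : ℂ) * τ (b k) = 0 := by
    intro τ
    have hw := congr_fun hg (mk τ)
    simp only [Finset.sum_apply, Pi.smul_apply, Pi.zero_apply, Complex.real_smul] at hw
    rcases embedding_mk_eq_or τ with h | h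
    · rwa [h] at hw
    · rw [h] at hw
      have := congrArg (starRingEnd ℂ) hw
      simpa [map_sum, ComplexEmbedding.conjugate_coe_eq, Complex.conj_ofReal] using this
  -- the square matrix `(τ (b k))` has non-zero determinant: `disc ≠ 0`
  have e : κ ≃ (K →ₐ[ℚ] ℂ) := Fintype.equivOfCardEq (by
    rw [AlgHom.card ℚ K ℂ, Module.finrank_eq_card_basis b])
  have hdet : (Algebra.embeddingsMatrixReindex ℚ ℂ b e).det ≠ 0 := by
    intro h0
    have hd := Algebra.discr_eq_det_embeddingsMatrixReindex_pow_two ℚ ℂ b e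
    rw [h0, zero_pow two_ne_zero, map_eq_zero] at hd
    exact Algebra.discr_not_zero_of_basis ℚ b hd
  have hrows := Matrix.linearIndependent_rows_of_det_ne_zero hdet
  have hzero := Fintype.linearIndependent_iff.mp hrows (fun k ↦ (g k : ℂ)) (by
    funext j
    simp only [Finset.sum_apply, Pi.smul_apply, smul_eq_mul, Pi.zero_apply, Algebra.embeddingsMatrixReindex,
      Matrix.reindex_apply, Matrix.submatrix_apply, Equiv.refl_symm, Equiv.coe_refl,
      Equiv.symm_symm, Algebra.embeddingsMatrix_apply]
    simpa using h1 (e j : K →ₐ[ℚ] ℂ))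
  intro k
  exact_mod_cast hzero k

/-- The Minkowski lattice `μ(𝓞_K)` as an additive subgroup of `ℂ^{r₁+r₂}` with its membership clause (the range
of the additive map `x ↦ (w.embedding x)_w` on `𝓞_K`).
[cite: Vallieres2012ConnectedAbelianLieGroups, §3 Def. 6 (Minkowski map `μ_Φ`)] -/
theorem exists_addSubgroup_iff :
    ∃ Λ : AddSubgroup (InfinitePlace K → ℂ), ∀ v, v ∈ Λ ↔ ∃ x : 𝓞 K, (fun w ↦ (w.embedding (x : K) : ℂ)) = v := by
  refine ⟨AddMonoidHom.range ((AddMonoidHom.pi fun w : InfinitePlace K ↦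
    ((w.embedding : K →+* ℂ) : K →+ ℂ)).comp ((algebraMap (𝓞 K) K : 𝓞 K →+* K) : 𝓞 K →+ K)), fun v ↦ ?_⟩
  simp only [AddMonoidHom.mem_range, AddMonoidHom.coe_comp, Function.comp_apply]
  constructor
  · rintro ⟨x, rfl⟩
    exact ⟨x, by funext w; rfl⟩
  · rintro ⟨x, rfl⟩
    exact ⟨x, by funext w; rfl⟩

/-- The lattice `μ(𝓞_K)` is the `ℤ`-span of the Minkowski vectors of an integral basis. [folklore] -/
private theorem coe_eq_span_range (Λ : AddSubgroup (InfinitePlace K → ℂ))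
    (hΛ : ∀ v, v ∈ Λ ↔ ∃ x : 𝓞 K, (fun w ↦ (w.embedding (x : K) : ℂ)) = v) :
    (Λ : Set (InfinitePlace K → ℂ)) =
      Submodule.span ℤ (Set.range fun k w ↦ ((w : InfinitePlace K).embedding (integralBasis K k) : ℂ)) := by
  classical
  -- the `ℤ`-linear Minkowski map on `K`
  let μ : K →ₗ[ℤ] (InfinitePlace K → ℂ) :=
    { toFun := fun x w ↦ (w.embedding x : ℂ)
      map_add' := fun x y ↦ by funext w; simp
      map_smul' := fun n x ↦ by funext w; simp }
  have hrange : (Set.range fun k w ↦ ((w : InfinitePlace K).embedding (integralBasis K k) : ℂ)) =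
      μ '' Set.range (integralBasis K) := by
    ext v
    simp only [Set.mem_range, Set.mem_image, exists_exists_eq_and]
    rfl
  rw [hrange, ← Submodule.map_span, Submodule.map_coe]
  ext v
  simp only [SetLike.mem_coe, hΛ, Set.mem_image]
  constructor
  · rintro ⟨x, rfl⟩
    exact ⟨(x : K), mem_span_integralBasis K |>.mpr ⟨x, rfl⟩, rfl⟩
  · rintro ⟨y, hy, rfl⟩
    obtain ⟨x, rfl⟩ := (mem_span_integralBasis K).mp hy
    exact ⟨x, rfl⟩

/-- **THEOREM 4: `μ(𝓞_K)` is a lattice** — a DISCRETE subgroup of `ℂ^{r₁+r₂}` (the `ℤ`-span of `ℝ`-linearly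
independent vectors). [cite: Vallieres2012ConnectedAbelianLieGroups, §3 Thm. 4 (pp. 212–213)] -/
theorem discreteTopology_of_forall_mem_iff (Λ : AddSubgroup (InfinitePlace K → ℂ))
    (hΛ : ∀ v, v ∈ Λ ↔ ∃ x : 𝓞 K, (fun w ↦ (w.embedding (x : K) : ℂ)) = v) : DiscreteTopology Λ := by
  classical
  have hd := Literature.Algebra.Module.discreteTopology_span_int_of_linearIndependent
    (linearIndependent_real_minkowski (integralBasis K))
  have hset := coe_eq_span_range Λ hΛ
  rw [discreteTopology_iff_isOpen_singleton_zero] at hd ⊢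
  obtain ⟨U, hU, hU0⟩ := isOpen_induced_iff.mp hd
  refine isOpen_induced_iff.mpr ⟨U, hU, ?_⟩
  ext ⟨v, hv⟩
  have hv' : v ∈ Submodule.span ℤ
      (Set.range fun k w ↦ ((w : InfinitePlace K).embedding (integralBasis K k) : ℂ)) := by
    rw [← SetLike.mem_coe, ← hset]; exact hv
  have := congrArg (fun s : Set _ ↦ (⟨v, hv'⟩ : Submodule.span ℤ _) ∈ s) hU0
  simp only [Set.mem_preimage, Set.mem_singleton_iff, Subtype.ext_iff, eq_iff_iff] at this
  simpa [Set.mem_preimage, Subtype.ext_iff] using this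

/-- A `ℂ`-linear functional on `ℂ^{r₁+r₂}` is `v ↦ Σ_w v_w σ(e_w)`. [folklore] -/
private theorem clm_pi_apply_eq_sum [DecidableEq (InfinitePlace K)] (σ : (InfinitePlace K → ℂ) →L[ℂ] ℂ)
    (v : InfinitePlace K → ℂ) : σ v = ∑ w, σ (Pi.single w 1) * v w := by
  conv_lhs => rw [pi_eq_sum_univ' v]
  rw [map_sum]
  refine sum_congr rfl fun w _ ↦ ?_
  rw [map_smul, smul_eq_mul, mul_comm]

/-- **THEOREM 4 (second bullet): `rank_ℂ μ(𝓞_K) = r₁ + r₂`** — the lattice spans `ℂ^{r₁+r₂}` over `ℂ` (a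
functional vanishing on it is a combination of the distinct embeddings `w.embedding` vanishing on `K`).
[cite: Vallieres2012ConnectedAbelianLieGroups, §3 Thm. 4 (p. 213: «the matrix `(σ_i(β_j))` has full rank»)] -/
theorem span_eq_top_of_forall_mem_iff (Λ : AddSubgroup (InfinitePlace K → ℂ))
    (hΛ : ∀ v, v ∈ Λ ↔ ∃ x : 𝓞 K, (fun w ↦ (w.embedding (x : K) : ℂ)) = v) :
    Submodule.span ℂ (Λ : Set (InfinitePlace K → ℂ)) = ⊤ := by
  classical
  by_contra hne
  obtain ⟨φ, hφ0, hφ⟩ :=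
    Submodule.exists_dual_map_eq_bot_of_lt_top (lt_top_iff_ne_top.2 hne) inferInstance
  have hφ' : ∀ l ∈ Λ, φ l = 0 := fun l hl ↦ by
    have : φ l ∈ (Submodule.span ℂ (Λ : Set _)).map φ := Submodule.mem_map_of_mem (Submodule.subset_span hl)
    rwa [hφ, Submodule.mem_bot] at this
  set σ : (InfinitePlace K → ℂ) →L[ℂ] ℂ := LinearMap.toContinuousLinearMap φ with hσ
  have hc : (fun w : InfinitePlace K ↦ σ (Pi.single w 1)) = 0 := by
    refine eq_zero_of_sum_mul_embedding_eq_zero (fun w : InfinitePlace K ↦ w.embedding)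
      (embedding_injective K) (integralBasis K) _ fun k ↦ ?_
    rw [← clm_pi_apply_eq_sum σ]
    exact hφ' _ ((hΛ _).mpr ⟨RingOfIntegers.basis K k, by funext w; simp [integralBasis_apply]⟩)
  apply hφ0
  refine LinearMap.ext fun v ↦ ?_
  have h1 := clm_pi_apply_eq_sum σ v
  simp only [show ∀ w, σ (Pi.single w 1) = 0 from fun w ↦ congr_fun hc w, zero_mul, sum_const_zero] at h1
  simpa [hσ] using h1

/-! ## §3 Theorem 5 (Andreotti–Gherardelli, Abe): toroidal iff not totally real -/

omit [NumberField K] in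
/-- A complex place's conjugate embedding is not among the chosen representatives. [folklore] -/
private theorem conjugate_embedding_ne {w₀ : InfinitePlace K} (hw₀ : IsComplex w₀) (w : InfinitePlace K) :
    w.embedding ≠ ComplexEmbedding.conjugate w₀.embedding := by
  intro h
  have hw : w = w₀ := by rw [← mk_embedding w, h, mk_conjugate_eq, mk_embedding]
  subst hw
  have hreal : ComplexEmbedding.IsReal w.embedding := ComplexEmbedding.isReal_iff.mpr h.symm
  exact (not_isReal_iff_isComplex.mpr hw₀) (isReal_iff.mpr hreal)

/-- **THEOREM 5 / ANDREOTTI–GHERARDELLI / ABE — the irrationality condition for `μ(𝓞_K)`**: if `K` has a complex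
place, no non-zero `ℂ`-linear functional on `ℂ^{r₁+r₂}` takes integer values on `μ(𝓞_K)` («Let `L ∈ Hom_ℂ(ℂ², ℂ)`
be such that `L(μ_Φ(𝔞)) ⊆ ℤ` … `L` is the trivial map»; general `K` by Dedekind's lemma with integral values,
the missing embedding being the conjugate of a complex place).
[cite: Vallieres2012ConnectedAbelianLieGroups, §3 Thm. 5 with proof and Remark (p. 214)]
[cite: DioguardiBurgioFalconeGalici2024, Introduction p. 341 (Abe's theorem for every non-totally real `K`)] -/
theorem eq_zero_of_forall_mem_exists_int (hK : ∃ w₀ : InfinitePlace K, IsComplex w₀)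
    (Λ : AddSubgroup (InfinitePlace K → ℂ))
    (hΛ : ∀ v, v ∈ Λ ↔ ∃ x : 𝓞 K, (fun w ↦ (w.embedding (x : K) : ℂ)) = v)
    (σ : (InfinitePlace K → ℂ) →L[ℂ] ℂ) (hσ : ∀ l ∈ Λ, ∃ m : ℤ, σ l = m) : σ = 0 := by
  classical
  obtain ⟨w₀, hw₀⟩ := hK
  have hc : (fun w : InfinitePlace K ↦ σ (Pi.single w 1)) = 0 := by
    refine eq_zero_of_sum_mul_embedding_mem_int (fun w : InfinitePlace K ↦ w.embedding) (embedding_injective K)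
      (τ₀ := ComplexEmbedding.conjugate w₀.embedding) (conjugate_embedding_ne hw₀) (integralBasis K) _
      fun k ↦ ?_
    rw [← clm_pi_apply_eq_sum σ]
    exact hσ _ ((hΛ _).mpr ⟨RingOfIntegers.basis K k, by funext w; simp [integralBasis_apply]⟩)
  refine ContinuousLinearMap.ext fun v ↦ ?_
  rw [clm_pi_apply_eq_sum σ v]
  simp only [show ∀ w, σ (Pi.single w 1) = 0 from fun w ↦ congr_fun hc w, zero_mul, sum_const_zero,
    _root_.zero_apply]

/-- **The totally real case is NOT toroidal** («If `K` is totally real, then … `ℂ^r/μ_Φ(𝔞) ≃ (ℂ^×)^{r₁}`»): the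
functional `v ↦ Σ_w v_w` is non-zero and takes on `μ(x)`, `x ∈ 𝓞_K`, the integer value `Tr_{K/ℚ}(x)` (all
embeddings are the chosen real representatives). [cite: Vallieres2012ConnectedAbelianLieGroups, §3.1 (p. 213,
sentence before Thm. 5) with Thm. 4 and Cor. 1] -/
theorem exists_ne_zero_forall_mem_exists_int (hK : ∀ w : InfinitePlace K, IsReal w)
    (Λ : AddSubgroup (InfinitePlace K → ℂ))
    (hΛ : ∀ v, v ∈ Λ ↔ ∃ x : 𝓞 K, (fun w ↦ (w.embedding (x : K) : ℂ)) = v) :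
    ∃ σ : (InfinitePlace K → ℂ) →L[ℂ] ℂ, σ ≠ 0 ∧ ∀ l ∈ Λ, ∃ m : ℤ, σ l = m := by
  classical
  refine ⟨∑ w : InfinitePlace K, ContinuousLinearMap.proj w, ?_, ?_⟩
  · intro h0
    have h1 := congrArg (fun τ : (InfinitePlace K → ℂ) →L[ℂ] ℂ ↦ τ (fun _ ↦ 1)) h0
    simp only [_root_.sum_apply, ContinuousLinearMap.proj_apply,
      sum_const, card_univ, nsmul_eq_mul, mul_one, _root_.zero_apply, Nat.cast_eq_zero] at h1
    exact Fintype.card_ne_zero h1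
  · intro l hl
    obtain ⟨x, rfl⟩ := (hΛ l).mp hl
    -- every embedding is the chosen (real) representative of its place
    have hsurj : Function.Surjective (fun w : InfinitePlace K ↦ (w.embedding : K →+* ℂ)) := fun τ ↦
      ⟨mk τ, embedding_mk_eq_of_isReal (isReal_iff.mp (hK (mk τ)) |> fun h ↦ by
        rcases embedding_mk_eq_or τ with h' | h'
        · exact ComplexEmbedding.isReal_iff.mpr (by rw [← h', ComplexEmbedding.isReal_iff.mp h])
        · have : ComplexEmbedding.IsReal (ComplexEmbedding.conjugate τ) := by rw [← h']; exact h
          exact ComplexEmbedding.isReal_conjugate_iff.mp this)⟩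
    have hbij : Function.Bijective (fun w : InfinitePlace K ↦ (w.embedding : K →+* ℂ)) :=
      ⟨embedding_injective K, hsurj⟩
    -- the value is the trace of the algebraic integer `x`
    have htr : (∑ w : InfinitePlace K, ContinuousLinearMap.proj (R := ℂ) w) (fun w ↦ (w.embedding (x : K) : ℂ)) =
        algebraMap ℚ ℂ (Algebra.trace ℚ K (x : K)) := by
      rw [trace_eq_sum_embeddings ℂ, _root_.sum_apply]
      simp only [ContinuousLinearMap.proj_apply]
      exact Fintype.sum_bijective (fun w : InfinitePlace K ↦ RingHom.equivRatAlgHom (w.embedding : K →+* ℂ))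
        (RingHom.equivRatAlgHom.bijective.comp hbij) _ _ fun w ↦ rfl
    obtain ⟨m, hm⟩ : ∃ m : ℤ, algebraMap ℤ ℚ m = Algebra.trace ℚ K (x : K) :=
      IsIntegrallyClosed.isIntegral_iff.mp (Algebra.isIntegral_trace x.isIntegral_coe)
    refine ⟨m, ?_⟩
    rw [htr, ← hm]
    simp

/-- **`ℂ^{r₁+r₂}/μ(𝓞_K)` IS TOROIDAL IFF `K` IS NOT TOTALLY REAL** (VALLIÈRES Thm. 5 and Remark, §3.1;
ANDREOTTI–GHERARDELLI; ABE): every `μ(𝓞_K)`-periodic entire function on `ℂ^{r₁+r₂}` is constant iff `K` has a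
complex place — via the tree's irrationality criterion `ToroidalGroup.forall_periodic_const_iff_forall_eq_zero`
(AK Thm. 1.1.4).
[cite: Vallieres2012ConnectedAbelianLieGroups, §3 Thm. 5, Remark, and §3.1 (pp. 213–214); Thm. 2 (irrationality
condition)] [cite: DioguardiBurgioFalconeGalici2024, Introduction p. 341]
[cite: AbeKopfermann2001, §1.1 Thm. 1.1.4] -/
theorem forall_periodic_const_iff_exists_isComplex (Λ : AddSubgroup (InfinitePlace K → ℂ))
    (hΛ : ∀ v, v ∈ Λ ↔ ∃ x : 𝓞 K, (fun w ↦ (w.embedding (x : K) : ℂ)) = v) :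
    (∀ f : (InfinitePlace K → ℂ) → ℂ, Differentiable ℂ f → (∀ l ∈ Λ, ∀ z, f (z + l) = f z) →
      ∀ z z', f z = f z') ↔ ∃ w : InfinitePlace K, IsComplex w := by
  rw [forall_periodic_const_iff_forall_eq_zero Λ]
  constructor
  · intro h
    by_contra hno
    have hreal : ∀ w : InfinitePlace K, IsReal w := fun w ↦
      not_isComplex_iff_isReal.mp fun hw ↦ hno ⟨w, hw⟩
    obtain ⟨σ, hσ0, hσ⟩ := exists_ne_zero_forall_mem_exists_int hreal Λ hΛ
    exact hσ0 (h σ hσ)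
  · intro hK σ hσ
    exact eq_zero_of_forall_mem_exists_int hK Λ hΛ σ hσ

/-! ## §4 The same for an arbitrary full module `𝔪 ⊂ K` (fractional ideals, orders)

VALLIÈRES states Theorem 4 for «any free `ℤ`-module `𝔪` of rank `n` in `K`» and Theorem 5 for a fractional
ideal `𝔞`; at the lattice level such an `𝔪` is the `ℤ`-span of a `ℚ`-basis `b` of `K`, and the proofs above
apply verbatim (they only used that `μ(𝓞_K)` is the `ℤ`-span of the Minkowski vectors of the `ℚ`-basis
`integralBasis K`). -/

/-- The lattice `μ(𝔪)`, `𝔪 = ℤb₁ ⊕ ⋯ ⊕ ℤb_n`, is the `ℤ`-span of the Minkowski vectors `μ(b_k)`. [folklore] -/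
private theorem coe_eq_span_range_of_basis {κ : Type*} (b : Module.Basis κ ℚ K)
    (Λ : AddSubgroup (InfinitePlace K → ℂ))
    (hΛ : ∀ v, v ∈ Λ ↔ ∃ x ∈ Submodule.span ℤ (Set.range b), (fun w ↦ (w.embedding x : ℂ)) = v) :
    (Λ : Set (InfinitePlace K → ℂ)) =
      Submodule.span ℤ (Set.range fun k w ↦ ((w : InfinitePlace K).embedding (b k) : ℂ)) := by
  classical
  let μ : K →ₗ[ℤ] (InfinitePlace K → ℂ) :=
    { toFun := fun x w ↦ (w.embedding x : ℂ)
      map_add' := fun x y ↦ by funext w; simp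
      map_smul' := fun n x ↦ by funext w; simp }
  have hrange : (Set.range fun k w ↦ ((w : InfinitePlace K).embedding (b k) : ℂ)) = μ '' Set.range b := by
    ext v
    simp only [Set.mem_range, Set.mem_image, exists_exists_eq_and]
    rfl
  rw [hrange, ← Submodule.map_span, Submodule.map_coe]
  ext v
  simp only [SetLike.mem_coe, hΛ, Set.mem_image]
  constructor
  · rintro ⟨x, hx, rfl⟩
    exact ⟨x, hx, rfl⟩
  · rintro ⟨x, hx, rfl⟩
    exact ⟨x, hx, rfl⟩

/-- **THEOREM 4 for a full module `𝔪 = ℤb₁ ⊕ ⋯ ⊕ ℤb_n`** (`b` a `ℚ`-basis of `K`; e.g. a fractional ideal or an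
order): `μ_Φ(𝔪)` is a DISCRETE subgroup of `ℂ^{r₁+r₂}`.
[cite: Vallieres2012ConnectedAbelianLieGroups, §3 Thm. 4 («Given any free `ℤ`-module `𝔪` of rank `n` in `K`, the
free `ℤ`-module `μ_Φ(𝔪)` is in fact a lattice in `ℂ^r`»)] -/
theorem discreteTopology_of_forall_mem_iff_span {κ : Type*} [Fintype κ] (b : Module.Basis κ ℚ K)
    (Λ : AddSubgroup (InfinitePlace K → ℂ))
    (hΛ : ∀ v, v ∈ Λ ↔ ∃ x ∈ Submodule.span ℤ (Set.range b), (fun w ↦ (w.embedding x : ℂ)) = v) :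
    DiscreteTopology Λ := by
  classical
  have hd := Literature.Algebra.Module.discreteTopology_span_int_of_linearIndependent
    (linearIndependent_real_minkowski b)
  have hset := coe_eq_span_range_of_basis b Λ hΛ
  rw [discreteTopology_iff_isOpen_singleton_zero] at hd ⊢
  obtain ⟨U, hU, hU0⟩ := isOpen_induced_iff.mp hd
  refine isOpen_induced_iff.mpr ⟨U, hU, ?_⟩
  ext ⟨v, hv⟩
  have hv' : v ∈ Submodule.span ℤ (Set.range fun k w ↦ ((w : InfinitePlace K).embedding (b k) : ℂ)) := by
    rw [← SetLike.mem_coe, ← hset]; exact hv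
  have := congrArg (fun s : Set _ ↦ (⟨v, hv'⟩ : Submodule.span ℤ _) ∈ s) hU0
  simp only [Set.mem_preimage, Set.mem_singleton_iff, Subtype.ext_iff, eq_iff_iff] at this
  simpa [Set.mem_preimage, Subtype.ext_iff] using this

/-- **THEOREM 4 for a full module: `rank_ℂ μ_Φ(𝔪) = r₁ + r₂`** — `μ_Φ(𝔪)` spans `ℂ^{r₁+r₂}` over `ℂ`.
[cite: Vallieres2012ConnectedAbelianLieGroups, §3 Thm. 4, second bullet] -/
theorem span_eq_top_of_forall_mem_iff_span {κ : Type*} [Fintype κ] (b : Module.Basis κ ℚ K)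
    (Λ : AddSubgroup (InfinitePlace K → ℂ))
    (hΛ : ∀ v, v ∈ Λ ↔ ∃ x ∈ Submodule.span ℤ (Set.range b), (fun w ↦ (w.embedding x : ℂ)) = v) :
    Submodule.span ℂ (Λ : Set (InfinitePlace K → ℂ)) = ⊤ := by
  classical
  by_contra hne
  obtain ⟨φ, hφ0, hφ⟩ :=
    Submodule.exists_dual_map_eq_bot_of_lt_top (lt_top_iff_ne_top.2 hne) inferInstance
  have hφ' : ∀ l ∈ Λ, φ l = 0 := fun l hl ↦ by
    have : φ l ∈ (Submodule.span ℂ (Λ : Set _)).map φ := Submodule.mem_map_of_mem (Submodule.subset_span hl)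
    rwa [hφ, Submodule.mem_bot] at this
  set σ : (InfinitePlace K → ℂ) →L[ℂ] ℂ := LinearMap.toContinuousLinearMap φ with hσ
  have hc : (fun w : InfinitePlace K ↦ σ (Pi.single w 1)) = 0 := by
    refine eq_zero_of_sum_mul_embedding_eq_zero (fun w : InfinitePlace K ↦ w.embedding)
      (embedding_injective K) b _ fun k ↦ ?_
    rw [← clm_pi_apply_eq_sum σ]
    exact hφ' _ ((hΛ _).mpr ⟨b k, Submodule.subset_span ⟨k, rfl⟩, rfl⟩)
  apply hφ0
  refine LinearMap.ext fun v ↦ ?_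
  have h1 := clm_pi_apply_eq_sum σ v
  simp only [show ∀ w, σ (Pi.single w 1) = 0 from fun w ↦ congr_fun hc w, zero_mul, sum_const_zero] at h1
  simpa [hσ] using h1

/-- **THEOREM 5 for a full module `𝔪` (e.g. a fractional ideal `𝔞`) of a number field with a complex place**:
the irrationality condition holds for `μ_Φ(𝔪)` («`ℂ²/μ_Φ(𝔞)` is a Cousin group»; general `K` as in
`eq_zero_of_forall_mem_exists_int`).
[cite: Vallieres2012ConnectedAbelianLieGroups, §3 Thm. 5 with proof and Remark (p. 214)]
[cite: DioguardiBurgioFalconeGalici2024, Introduction p. 341] -/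
theorem eq_zero_of_forall_mem_exists_int_span (hK : ∃ w₀ : InfinitePlace K, IsComplex w₀)
    {κ : Type*} [Fintype κ] (b : Module.Basis κ ℚ K) (Λ : AddSubgroup (InfinitePlace K → ℂ))
    (hΛ : ∀ v, v ∈ Λ ↔ ∃ x ∈ Submodule.span ℤ (Set.range b), (fun w ↦ (w.embedding x : ℂ)) = v)
    (σ : (InfinitePlace K → ℂ) →L[ℂ] ℂ) (hσ : ∀ l ∈ Λ, ∃ m : ℤ, σ l = m) : σ = 0 := by
  classical
  obtain ⟨w₀, hw₀⟩ := hK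
  have hc : (fun w : InfinitePlace K ↦ σ (Pi.single w 1)) = 0 := by
    refine eq_zero_of_sum_mul_embedding_mem_int (fun w : InfinitePlace K ↦ w.embedding) (embedding_injective K)
      (τ₀ := ComplexEmbedding.conjugate w₀.embedding) (conjugate_embedding_ne hw₀) b _ fun k ↦ ?_
    rw [← clm_pi_apply_eq_sum σ]
    exact hσ _ ((hΛ _).mpr ⟨b k, Submodule.subset_span ⟨k, rfl⟩, rfl⟩)
  refine ContinuousLinearMap.ext fun v ↦ ?_
  rw [clm_pi_apply_eq_sum σ v]
  simp only [show ∀ w, σ (Pi.single w 1) = 0 from fun w ↦ congr_fun hc w, zero_mul, sum_const_zero,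
    _root_.zero_apply]

/-- **`ℂ^{r₁+r₂}/μ_Φ(𝔪)` is toroidal for every full module `𝔪` of a number field with a complex place**
(VALLIÈRES Thm. 5 for fractional ideals of non-totally real cubic fields and, by the Remark, for `r₁ = 1`;
general `K` as above), via the tree's irrationality criterion.
[cite: Vallieres2012ConnectedAbelianLieGroups, §3 Thm. 5, Remark; Thm. 2]
[cite: AbeKopfermann2001, §1.1 Thm. 1.1.4] -/
theorem forall_periodic_const_of_exists_isComplex_span (hK : ∃ w₀ : InfinitePlace K, IsComplex w₀)
    {κ : Type*} [Fintype κ] (b : Module.Basis κ ℚ K) (Λ : AddSubgroup (InfinitePlace K → ℂ))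
    (hΛ : ∀ v, v ∈ Λ ↔ ∃ x ∈ Submodule.span ℤ (Set.range b), (fun w ↦ (w.embedding x : ℂ)) = v)
    (f : (InfinitePlace K → ℂ) → ℂ) (hf : Differentiable ℂ f) (hper : ∀ l ∈ Λ, ∀ z, f (z + l) = f z)
    (z z' : InfinitePlace K → ℂ) : f z = f z' :=
  (forall_periodic_const_iff_forall_eq_zero Λ).mpr (eq_zero_of_forall_mem_exists_int_span hK b Λ hΛ) f hf hper
    z z'

/-! ## §5 Extra multiplications: `𝓞_K` acts on `ℂ^{r₁+r₂}/μ_Φ(𝔪)` (Vallières Thm. 9, first part)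

«**Definition 7.** Let `G` be a Cousin group. We shall say that `G` admits extra multiplication if `ℤ` is
strictly included in `End(G)` but not equal to it.» «**Theorem 9.** Let `K` be a non-totally real cubic number
field, and let `Φ = {σ₁, σ₂}` be a type. … let also `𝔞` be any fractional ideal of `K`, then `ℂ²/μ_Φ(𝔞)` is a
Cousin group having extra multiplication. Moreover, for any `λ ∈ O_K` the matrix `ι(λ) = diag(σ₁(λ), σ₂(λ))`
induces an endomorphism of `ℂ²/μ_Φ(𝔞)` … *Proof.* It is clear that `ι(λ)` for any `λ ∈ O_K` induces an
endomorphism of `ℂ²/μ_Φ(𝔞)` because if `(σ₁(α), σ₂(α)) ∈ μ_Φ(𝔞)` then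
`ι(λ)·(σ₁(α), σ₂(α)) = (σ₁(λ·α), σ₂(λ·α))`, and `(σ₁(λ·α), σ₂(λ·α)) ∈ μ_Φ(𝔞)` since `𝔞` is a fractional ideal.
This also implies that this Cousin group has extra multiplication.» (p. 221–222).  In the tree's dictionary
(`ToroidalGroupHolomorphicMaps`: endomorphisms of `ℂⁿ/Λ` = `ℂ`-linear maps `T` with `T(Λ) ⊆ Λ`) the
endomorphism `ι(λ)` is the diagonal map `ContinuousLinearMap.mul ℂ _ (μ λ)` (coordinatewise multiplication by
`(w.embedding λ)_w`); here for every number field `K`, every type, and every `𝓞_K`-stable `ℤ`-submodule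
`𝔪 ⊂ K`.  (The second part of Thm. 9, `O_K ≃ End`, `K ≃ End⁰` for cubic `K`, rests on §3.2 and is not
formalised here.) -/

/-- **`ι(λ)` preserves `μ_Φ(𝔪)`** for `λ ∈ 𝓞_K` and an `𝓞_K`-stable `𝔪` (e.g. a fractional ideal):
`ι(λ) μ(α) = μ(λα)`. [cite: Vallieres2012ConnectedAbelianLieGroups, §3.3 Thm. 9, first part of the proof
(pp. 221–222)] -/
theorem mul_minkowski_mem (M : Submodule ℤ K) (hM : ∀ (c : 𝓞 K) (x : K), x ∈ M → (c : K) * x ∈ M)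
    (Λ : AddSubgroup (InfinitePlace K → ℂ))
    (hΛ : ∀ v, v ∈ Λ ↔ ∃ x ∈ M, (fun w ↦ (w.embedding x : ℂ)) = v) (c : 𝓞 K) {l : InfinitePlace K → ℂ}
    (hl : l ∈ Λ) :
    ContinuousLinearMap.mul ℂ (InfinitePlace K → ℂ) (fun w ↦ (w.embedding (c : K) : ℂ)) l ∈ Λ := by
  obtain ⟨x, hx, rfl⟩ := (hΛ l).mp hl
  refine (hΛ _).mpr ⟨(c : K) * x, hM c x hx, ?_⟩
  funext w
  simp [ContinuousLinearMap.mul_apply', map_mul]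

/-- The same for `𝔪 = 𝓞_K` with the membership clause of §2–§3.
[cite: Vallieres2012ConnectedAbelianLieGroups, §3.3 Thm. 9, first part of the proof] -/
theorem mul_minkowski_mem_ringOfIntegers (Λ : AddSubgroup (InfinitePlace K → ℂ))
    (hΛ : ∀ v, v ∈ Λ ↔ ∃ x : 𝓞 K, (fun w ↦ (w.embedding (x : K) : ℂ)) = v) (c : 𝓞 K)
    {l : InfinitePlace K → ℂ} (hl : l ∈ Λ) :
    ContinuousLinearMap.mul ℂ (InfinitePlace K → ℂ) (fun w ↦ (w.embedding (c : K) : ℂ)) l ∈ Λ := by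
  obtain ⟨x, rfl⟩ := (hΛ l).mp hl
  refine (hΛ _).mpr ⟨c * x, ?_⟩
  funext w
  simp [ContinuousLinearMap.mul_apply', map_mul]

/-- `λ ↦ ι(λ)` is multiplicative (`ι(λλ') = ι(λ) ∘ ι(λ')`) — with additivity (linearity of `mul`) this is the
ring homomorphism `O_K → End(ℂ^r/μ_Φ(𝔞))` of Thm. 9. [cite: Vallieres2012ConnectedAbelianLieGroups, §3.3
Thm. 9 («The map `O_K → End(ℂ²/μ_Φ(𝔞))`, defined by `λ ↦ ι(λ)`»)] -/
theorem mul_minkowski_mul (c c' : 𝓞 K) :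
    ContinuousLinearMap.mul ℂ (InfinitePlace K → ℂ) (fun w ↦ (w.embedding ((c * c' : 𝓞 K) : K) : ℂ)) =
      (ContinuousLinearMap.mul ℂ (InfinitePlace K → ℂ) (fun w ↦ (w.embedding (c : K) : ℂ))).comp
        (ContinuousLinearMap.mul ℂ (InfinitePlace K → ℂ) (fun w ↦ (w.embedding (c' : K) : ℂ))) := by
  refine ContinuousLinearMap.ext fun v ↦ ?_
  funext w
  simp [ContinuousLinearMap.mul_apply', map_mul, mul_assoc]

/-- `λ ↦ ι(λ)` is injective. [cite: Vallieres2012ConnectedAbelianLieGroups, §3.3 Thm. 9 («`ι : O_K ↪ End`»,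
(3.17))] -/
theorem mul_minkowski_injective :
    Function.Injective fun c : 𝓞 K ↦
      ContinuousLinearMap.mul ℂ (InfinitePlace K → ℂ) (fun w ↦ (w.embedding (c : K) : ℂ)) := by
  classical
  intro c c' h
  obtain ⟨w⟩ := (inferInstance : Nonempty (InfinitePlace K))
  have h1 := congr_fun (congrArg (fun T : (InfinitePlace K → ℂ) →L[ℂ] (InfinitePlace K → ℂ) ↦ T (fun _ ↦ 1)) h) w
  simp only [ContinuousLinearMap.mul_apply', Pi.mul_apply, mul_one] at h1
  exact RingOfIntegers.ext ((w.embedding).injective h1)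

/-- **EXTRA MULTIPLICATION** («`ℂ²/μ_Φ(𝔞)` is a Cousin group having extra multiplication»): if `K ≠ ℚ` then
`ℂ^{r₁+r₂}/μ_Φ(𝔪)` (for any `𝓞_K`-stable full module `𝔪`, in particular `𝓞_K` and the fractional ideals) has an
endomorphism which is not multiplication by an integer — namely `ι(λ)` for an element `λ` of an integral basis
which is not a rational integer.
[cite: Vallieres2012ConnectedAbelianLieGroups, §3.2 Def. 7, §3.3 Thm. 9 (first assertion) with proof] -/
theorem exists_endomorphism_ne_intCast (hK : 1 < Module.finrank ℚ K) (M : Submodule ℤ K)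
    (hM : ∀ (c : 𝓞 K) (x : K), x ∈ M → (c : K) * x ∈ M) (Λ : AddSubgroup (InfinitePlace K → ℂ))
    (hΛ : ∀ v, v ∈ Λ ↔ ∃ x ∈ M, (fun w ↦ (w.embedding x : ℂ)) = v) :
    ∃ T : (InfinitePlace K → ℂ) →L[ℂ] (InfinitePlace K → ℂ),
      (∀ l ∈ Λ, T l ∈ Λ) ∧ ∀ n : ℤ, T ≠ (n : ℂ) • ContinuousLinearMap.id ℂ (InfinitePlace K → ℂ) := by
  classical
  -- an element of the integral basis which is not a rational integer
  obtain ⟨c, hc⟩ : ∃ c : 𝓞 K, ∀ n : ℤ, (c : K) ≠ n := by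
    by_contra! hall
    -- then every vector of the `ℚ`-basis `integralBasis K` lies on the line `ℚ·1`, so `[K:ℚ] ≤ 1`
    have hsub : ∀ i, integralBasis K i ∈ Submodule.span ℚ ({1} : Set K) := fun i ↦ by
      obtain ⟨n, hn⟩ := hall (RingOfIntegers.basis K i)
      rw [integralBasis_apply, ← RingOfIntegers.coe_eq_algebraMap, hn]
      exact Submodule.mem_span_singleton.mpr ⟨(n : ℚ), by simp⟩
    have htop : (⊤ : Submodule ℚ K) ≤ Submodule.span ℚ ({1} : Set K) := by
      rw [← (integralBasis K).span_eq]
      exact Submodule.span_le.mpr (by rintro _ ⟨i, rfl⟩; exact hsub i)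
    have hle : Module.finrank ℚ K ≤ 1 := by
      have h1 := Submodule.finrank_mono htop
      rw [finrank_top] at h1
      exact h1.trans ((finrank_span_le_card ({1} : Set K)).trans (by simp))
    omega
  refine ⟨ContinuousLinearMap.mul ℂ (InfinitePlace K → ℂ) (fun w ↦ (w.embedding (c : K) : ℂ)),
    fun l hl ↦ mul_minkowski_mem M hM Λ hΛ c hl, fun n h ↦ hc n ?_⟩
  obtain ⟨w⟩ := (inferInstance : Nonempty (InfinitePlace K))
  have h1 := congr_fun (congrArg (fun T : (InfinitePlace K → ℂ) →L[ℂ] (InfinitePlace K → ℂ) ↦ T (fun _ ↦ 1)) h) w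
  simp only [ContinuousLinearMap.mul_apply', Pi.mul_apply, mul_one, _root_.smul_apply,
    Pi.smul_apply, ContinuousLinearMap.coe_id', id_eq, smul_eq_mul] at h1
  exact (w.embedding).injective (by simpa using h1)

end ToroidalGroup

end Literature.Geometry.Kaehler
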